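import Mathlib
import HarnessLib
import Literature.NumberTheory.LFunctions.VanDerCorputDerivTests
import Literature.NumberTheory.LFunctions.RobertSargosPartialSummation

/-!
# Robert–Sargos 2002, Lemma 3: the third derivative test with a `C¹` perturbation (weak form) — PROVED

Topic `Literature/NumberTheory/LFunctions`. Everything in this file is PROVED (no `sorry`, no named
facts). Lemma 3 (§2.3) of O. Robert, P. Sargos, *A fourth derivative test for exponential sums*,
Compositio Math. 130 (2002) 275–292 (= arXiv:2307.03562v1) reads: for `g ∈ C³`, `u ∈ C¹` on `[1, M]`
with `μ ≤ |g'''| ≪ μ` and `u' ≪ μ^{1/2}` (2·6), `∑_{m ≤ M} e(g(m) + u(m)) ≪ Mμ^{1/6} + μ^{-1/3}` (2·7);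
"If `u ≡ 0`, Lemma 3 is the third derivative test. If `M ≪ μ^{-1/2}`, we can eliminate without cost the
term `u(m)` by a (one dimensional) partial summation. Now, we suppose `M ≫ μ^{-1/2}`. Then we divide the
initial sum into `O(Mμ^{1/2})` sums of length `μ^{-1/2}` and we apply the previous case to each short
sum." It is used in Step 2 of the proof of their Theorem 1 (the terms `q = 0`, `r ≠ 0`).

Here the same argument is run on top of the third derivative test available in the tree,
`Literature.NumberTheory.LFunctions.VdC.thirdDerivTest` (Titchmarsh 5.11 / Graham–Kolesnik 2.6 shape,
secondary term `(b-a)^{1/2}λ^{-1/6}` instead of the sharper `λ^{-1/3}` of Sargos 1995 used in print),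
which yields the WEAKER but sufficient conclusion

  `|∑_{a<n≤b} e(f(n) + u(n))| ≤ 1400 h (1 + 4πC₁) ((b-a) μ^{1/12} + (b-a)^{1/2} μ^{-1/6})`

(`RobertSargos.thirdDerivTest_perturb`) under `μ ≤ ±f''' ≤ hμ` (`0 < μ ≤ 1`, via a derivative family
`D`, `D 0 = f`), `|u(y) - u(x)| ≤ C₁ μ^{1/2}(y - x)` for `a ≤ x ≤ y ≤ b` (the Lipschitz form of
`u' ≪ μ^{1/2}`): on blocks of length `≤ 2μ^{-1/2}` the perturbation is removed by the tree's discrete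
partial summation `RobertSargos.partialSummation₁` (the variation of `e(u(n))` is `≤ 4πC₁` there), each
block costs `≪ μ^{-5/12}`, and there are `≤ 2(b-a)μ^{1/2}` blocks. The exponent `1/12` (in place of the
printed `1/6`) is what this weaker block bound gives; it suffices in Step 2 of [RS] (see the assembly).

## References

* O. Robert, P. Sargos, *A fourth derivative test for exponential sums*, Compositio Math. 130 (2002),
  275–292, doi:10.1023/A:1014363224308 = arXiv:2307.03562v1 — §2.3, Lemma 3, (2·6)–(2·7). [RobertSargos2002]
* E. C. Titchmarsh, *The Theory of the Riemann Zeta-Function*, 2nd ed., Thm 5.11 (the tree's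
  `VdC.thirdDerivTest`). [Titchmarsh1986]
-/

noncomputable section

open Finset Real

namespace Literature.NumberTheory.LFunctions
namespace RobertSargos

open Literature.NumberTheory.LFunctions.VdC (e norm_e e_add e_neg DerivFamily thirdDerivTest)

/-! ### Small tools -/

/-- A derivative family on `[a, b]` restricts to any `[a', b'] ⊆ [a, b]`. [folklore] -/
theorem derivFamily_restrict {D : ℕ → ℝ → ℝ} {a b a' b' : ℝ} {k : ℕ} (hD : DerivFamily D a b k)
    (ha : a ≤ a') (hb : b' ≤ b) : DerivFamily D a' b' k :=
  fun j hj y hy => hD j hj y ⟨ha.trans hy.1, hy.2.trans hb⟩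

/-- The negated family `-D` is a derivative family. [folklore] -/
theorem derivFamily_neg {D : ℕ → ℝ → ℝ} {a b : ℝ} {k : ℕ} (hD : DerivFamily D a b k) :
    DerivFamily (fun j y => -D j y) a b k :=
  fun j hj y hy => (hD j hj y hy).neg

/-- `‖∑ e(-θ_n)‖ = ‖∑ e(θ_n)‖` (complex conjugation). [folklore] -/
theorem norm_sum_e_neg {s : Finset ℤ} (θ : ℤ → ℝ) :
    ‖∑ n ∈ s, e (-θ n)‖ = ‖∑ n ∈ s, e (θ n)‖ := by
  rw [← Complex.norm_conj (∑ n ∈ s, e (θ n)), map_sum]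
  congr 1
  exact Finset.sum_congr rfl fun n _ => e_neg _

/-- Reindexing `(a, a+L]` by `range L`. [folklore] -/
theorem sum_Ioc_eq_sum_range {M : Type*} [AddCommMonoid M] (F : ℤ → M) (a : ℤ) (L : ℕ) :
    ∑ n ∈ Finset.Ioc a (a + L), F n = ∑ i ∈ Finset.range L, F (a + 1 + i) := by
  induction L with
  | zero => simp
  | succ L ih =>
    rw [Finset.sum_range_succ, ← ih]
    have : Finset.Ioc a (a + ((L + 1 : ℕ) : ℤ)) = insert (a + 1 + L) (Finset.Ioc a (a + L)) := by
      ext n; simp only [Finset.mem_Ioc, Finset.mem_insert]; push_cast; omega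
    rw [this, Finset.sum_insert (by simp), add_comm]

/-! ### The third derivative test for either sign of `f'''` -/

/-- `VdC.thirdDerivTest` for `μ ≤ ±f''' ≤ hμ`. [cite: Titchmarsh1986, Thm 5.11] -/
theorem thirdDerivTest_signed {h : ℝ} (hh : 1 ≤ h) {lam : ℝ} (hlam : 0 < lam) {a b : ℤ}
    (hab : a < b) {D : ℕ → ℝ → ℝ} (hD : DerivFamily D a b 3)
    (hb : (∀ y ∈ Set.Icc (a : ℝ) b, lam ≤ D 3 y ∧ D 3 y ≤ h * lam) ∨
      (∀ y ∈ Set.Icc (a : ℝ) b, lam ≤ -D 3 y ∧ -D 3 y ≤ h * lam)) :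
    ‖∑ n ∈ Finset.Ioc a b, e (D 0 n)‖ ≤
      (96 * h) * (((b : ℝ) - a) * lam ^ (1 / 6 : ℝ) + ((b : ℝ) - a) ^ (1 / 2 : ℝ) * lam ^ (-(1 / 6 : ℝ))) := by
  rcases hb with hb | hb
  · have := thirdDerivTest hh lam hlam a b hab D hD hb
    norm_num at this ⊢; exact this
  · have hD' := derivFamily_neg hD
    have := thirdDerivTest hh lam hlam a b hab (fun j y => -D j y) hD' hb
    rw [norm_sum_e_neg] at this
    norm_num at this ⊢; exact this

/-! ### One block: removing the perturbation by partial summation -/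

/-- One block of length `L = b - a ≤ 2μ^{-1/2}`: the perturbation `u` (Lipschitz constant `C₁μ^{1/2}`)
is removed by partial summation (`RobertSargos.partialSummation₁`), at the cost of a factor
`2(1 + 4πC₁)`. [cite: RobertSargos2002, Lemma 3] -/
theorem block_bound {h C₁ μ : ℝ} (hh : 1 ≤ h) (hC₁ : 0 ≤ C₁) (hμ : 0 < μ) {a b : ℤ} (hab : a ≤ b)
    (hL : ((b : ℝ) - a) * μ ^ (1 / 2 : ℝ) ≤ 2) {D : ℕ → ℝ → ℝ} (hD : DerivFamily D a b 3)
    (hb : (∀ y ∈ Set.Icc (a : ℝ) b, μ ≤ D 3 y ∧ D 3 y ≤ h * μ) ∨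
      (∀ y ∈ Set.Icc (a : ℝ) b, μ ≤ -D 3 y ∧ -D 3 y ≤ h * μ))
    (u : ℝ → ℝ) (hu : ∀ x y : ℝ, (a : ℝ) ≤ x → x ≤ y → y ≤ b → |u y - u x| ≤ C₁ * μ ^ (1 / 2 : ℝ) * (y - x)) :
    ‖∑ n ∈ Finset.Ioc a b, e (D 0 n + u n)‖ ≤
      2 * (1 + 4 * π * C₁) * ((96 * h) * (((b : ℝ) - a) * μ ^ (1 / 6 : ℝ) +
        ((b : ℝ) - a) ^ (1 / 2 : ℝ) * μ ^ (-(1 / 6 : ℝ)))) := by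
  set L : ℕ := (b - a).toNat with hLdef
  have hLZ : (L : ℤ) = b - a := by rw [hLdef, Int.toNat_of_nonneg (by linarith)]
  have hLR : (L : ℝ) = (b : ℝ) - a := by exact_mod_cast hLZ
  have hbL : b = a + L := by linarith
  set Mx : ℝ := (96 * h) * (((b : ℝ) - a) * μ ^ (1 / 6 : ℝ) +
    ((b : ℝ) - a) ^ (1 / 2 : ℝ) * μ ^ (-(1 / 6 : ℝ))) with hMx
  have hMx0 : 0 ≤ Mx := by
    have : (0 : ℝ) ≤ (b : ℝ) - a := by rw [← hLR]; positivity
    positivity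
  -- reindex by `range L`
  rw [hbL, sum_Ioc_eq_sum_range (fun n => e (D 0 n + u n)) a L]
  simp_rw [e_add]
  -- partial summation with `I = {0}`
  have key := partialSummation₁ ({0} : Finset ℕ) L (fun _ i => e (D 0 ((a + 1 + i : ℤ) : ℝ)))
    (fun _ i => e (u ((a + 1 + i : ℤ) : ℝ))) (D := 1 + 4 * π * C₁) (Mx := Mx) (by positivity)
    (fun _ _ n _ => by rw [norm_e]; have : 0 ≤ 4 * π * C₁ := by positivity
                       linarith)
    (fun _ _ n hn => by
      -- `|e(u(n+1)) - e(u(n))| ≤ 2π C₁ μ^{1/2} ≤ (1 + 4πC₁)/L`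
      have h1 := norm_e_sub_e_le (u ((a + 1 + (n + 1 : ℕ) : ℤ) : ℝ)) (u ((a + 1 + n : ℤ) : ℝ))
      have h2 := hu ((a + 1 + n : ℤ) : ℝ) ((a + 1 + (n + 1 : ℕ) : ℤ) : ℝ) (by push_cast; linarith)
        (by push_cast; linarith) (by
          have : (n : ℝ) + 2 ≤ L := by
            have : n + 2 ≤ L := by omega
            exact_mod_cast this
          push_cast; linarith)
      have hL0 : (0 : ℝ) < L := by
        have : 0 < L := by omega
        exact_mod_cast this
      rw [le_div_iff₀ hL0]
      have h3 : ((a + 1 + (n + 1 : ℕ) : ℤ) : ℝ) - ((a + 1 + n : ℤ) : ℝ) = 1 := by push_cast; ring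
      rw [h3, mul_one] at h2
      have h4 : (L : ℝ) * (C₁ * μ ^ (1 / 2 : ℝ)) ≤ 2 * C₁ := by
        rw [hLR]; nlinarith [hL, hC₁]
      calc ‖e (u ((a + 1 + (n + 1 : ℕ) : ℤ) : ℝ)) - e (u ((a + 1 + n : ℤ) : ℝ))‖ * L
          ≤ 2 * π * |u ((a + 1 + (n + 1 : ℕ) : ℤ) : ℝ) - u ((a + 1 + n : ℤ) : ℝ)| * L := by gcongr
        _ ≤ 2 * π * (C₁ * μ ^ (1 / 2 : ℝ)) * L := by gcongr
        _ = 2 * π * ((L : ℝ) * (C₁ * μ ^ (1 / 2 : ℝ))) := by ring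
        _ ≤ 2 * π * (2 * C₁) := by gcongr
        _ ≤ 1 + 4 * π * C₁ := by nlinarith [Real.pi_pos])
    (fun N' hN' => by
      rw [Finset.sum_singleton]
      -- the partial sums are sums over `(a, a + N']`
      rcases Nat.eq_zero_or_pos N' with h0 | hpos
      · rw [h0]; simp; exact hMx0
      rw [← sum_Ioc_eq_sum_range (fun n => e (D 0 n)) a N']
      have hab' : a < a + N' := by omega
      have hsub : ((a + N' : ℤ) : ℝ) ≤ b := by
        have : a + (N' : ℤ) ≤ b := by omega
        exact_mod_cast this
      have hD' : DerivFamily D (a : ℝ) ((a + N' : ℤ) : ℝ) 3 :=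
        derivFamily_restrict hD le_rfl hsub
      have hb' : (∀ y ∈ Set.Icc (a : ℝ) ((a + N' : ℤ) : ℝ), μ ≤ D 3 y ∧ D 3 y ≤ h * μ) ∨
          (∀ y ∈ Set.Icc (a : ℝ) ((a + N' : ℤ) : ℝ), μ ≤ -D 3 y ∧ -D 3 y ≤ h * μ) := by
        rcases hb with hb | hb
        · exact Or.inl fun y hy => hb y ⟨hy.1, hy.2.trans hsub⟩
        · exact Or.inr fun y hy => hb y ⟨hy.1, hy.2.trans hsub⟩
      have h1 := thirdDerivTest_signed hh hμ hab' hD' hb'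
      refine h1.trans ?_
      rw [hMx]
      have hN'R : ((a + N' : ℤ) : ℝ) - a = N' := by push_cast; ring
      rw [hN'R]
      have hN'L : (N' : ℝ) ≤ (b : ℝ) - a := by rw [← hLR]; exact_mod_cast hN'
      have hN'0 : (0 : ℝ) ≤ N' := by positivity
      gcongr)
  try simp only [Finset.sum_singleton] at key
  calc ‖∑ i ∈ Finset.range L, e (D 0 ((a + 1 + i : ℤ) : ℝ)) * e (u ((a + 1 + i : ℤ) : ℝ))‖
      ≤ 2 * (1 + 4 * π * C₁) * Mx := key
    _ = _ := by rw [hMx]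

/-! ### Lemma 3 (weak form) -/

/-- **Robert–Sargos 2002, Lemma 3 (weak form).** Let `0 < μ ≤ 1`, `h ≥ 1`, `C₁ ≥ 0`, `a < b` integers,
`D` a derivative family of order `3` on `[a, b]` with `μ ≤ D 3 ≤ hμ` or `μ ≤ -D 3 ≤ hμ` there, and
`u : ℝ → ℝ` with `|u(y) - u(x)| ≤ C₁ μ^{1/2} (y - x)` for `a ≤ x ≤ y ≤ b`. Then
`|∑_{a<n≤b} e(D 0 n + u n)| ≤ 1400 h (1 + 4πC₁) ((b-a) μ^{1/12} + (b-a)^{1/2} μ^{-1/6})`.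
(Printed: `≪ Mμ^{1/6} + μ^{-1/3}` from the sharper third derivative test of Sargos 1995; the tree's
test gives this weaker form by the printed reduction — partial summation on blocks of length
`≍ μ^{-1/2}`.) [cite: RobertSargos2002, Lemma 3] -/
theorem thirdDerivTest_perturb {h C₁ μ : ℝ} (hh : 1 ≤ h) (hC₁ : 0 ≤ C₁) (hμ : 0 < μ) (hμ1 : μ ≤ 1)
    {a b : ℤ} (hab : a ≤ b) {D : ℕ → ℝ → ℝ} (hD : DerivFamily D a b 3)
    (hb : (∀ y ∈ Set.Icc (a : ℝ) b, μ ≤ D 3 y ∧ D 3 y ≤ h * μ) ∨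
      (∀ y ∈ Set.Icc (a : ℝ) b, μ ≤ -D 3 y ∧ -D 3 y ≤ h * μ))
    (u : ℝ → ℝ) (hu : ∀ x y : ℝ, (a : ℝ) ≤ x → x ≤ y → y ≤ b → |u y - u x| ≤ C₁ * μ ^ (1 / 2 : ℝ) * (y - x)) :
    ‖∑ n ∈ Finset.Ioc a b, e (D 0 n + u n)‖ ≤
      1400 * h * (1 + 4 * π * C₁) *
        (((b : ℝ) - a) * μ ^ (1 / 12 : ℝ) + ((b : ℝ) - a) ^ (1 / 2 : ℝ) * μ ^ (-(1 / 6 : ℝ))) := by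
  -- the block length `B = ⌈μ^{-1/2}⌉`
  set B : ℕ := ⌈μ ^ (-(1 / 2 : ℝ))⌉₊ with hBdef
  have hμhalf : 1 ≤ μ ^ (-(1 / 2 : ℝ)) := Real.one_le_rpow_of_pos_of_le_one_of_nonpos hμ hμ1 (by norm_num)
  have hB1 : 1 ≤ B := Nat.ceil_pos.mpr (by linarith) |> fun h => h
  have hBle : (B : ℝ) ≤ μ ^ (-(1 / 2 : ℝ)) + 1 := (Nat.ceil_lt_add_one (by positivity)).le
  have hBge : μ ^ (-(1 / 2 : ℝ)) ≤ B := Nat.le_ceil _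
  have hsqrt : μ ^ (-(1 / 2 : ℝ)) * μ ^ (1 / 2 : ℝ) = 1 := by
    rw [← Real.rpow_add hμ]; norm_num
  have hBμ : (B : ℝ) * μ ^ (1 / 2 : ℝ) ≤ 2 := by
    have h1 : μ ^ (1 / 2 : ℝ) ≤ 1 := Real.rpow_le_one hμ.le hμ1 (by norm_num)
    nlinarith [hBle, hsqrt, Real.rpow_nonneg hμ.le (1 / 2 : ℝ)]
  -- the bound for one block of length `≤ B`
  set K : ℝ := 2 * (1 + 4 * π * C₁) * (96 * h) with hK
  have hK0 : 0 ≤ K := by positivity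
  set blk : ℝ := K * ((B : ℝ) * μ ^ (1 / 6 : ℝ) + (B : ℝ) ^ (1 / 2 : ℝ) * μ ^ (-(1 / 6 : ℝ))) with hblk
  have hblk0 : 0 ≤ blk := by positivity
  have hblock : ∀ a' b' : ℤ, a ≤ a' → a' ≤ b' → b' ≤ b → b' - a' ≤ B →
      ‖∑ n ∈ Finset.Ioc a' b', e (D 0 n + u n)‖ ≤ blk := by
    intro a' b' ha' hab' hb' hlen
    have hlenR : ((b' : ℝ) - a') ≤ B := by exact_mod_cast hlen
    have hlen0 : (0 : ℝ) ≤ (b' : ℝ) - a' := by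
      have : (0 : ℤ) ≤ b' - a' := by omega
      exact_mod_cast this
    have hL : ((b' : ℝ) - a') * μ ^ (1 / 2 : ℝ) ≤ 2 :=
      le_trans (mul_le_mul_of_nonneg_right hlenR (by positivity)) hBμ
    have hD' : DerivFamily D (a' : ℝ) (b' : ℝ) 3 :=
      derivFamily_restrict hD (by exact_mod_cast ha') (by exact_mod_cast hb')
    have hbb : (∀ y ∈ Set.Icc (a' : ℝ) b', μ ≤ D 3 y ∧ D 3 y ≤ h * μ) ∨
        (∀ y ∈ Set.Icc (a' : ℝ) b', μ ≤ -D 3 y ∧ -D 3 y ≤ h * μ) := by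
      have hsub : Set.Icc (a' : ℝ) b' ⊆ Set.Icc (a : ℝ) b :=
        Set.Icc_subset_Icc (by exact_mod_cast ha') (by exact_mod_cast hb')
      rcases hb with hb | hb
      · exact Or.inl fun y hy => hb y (hsub hy)
      · exact Or.inr fun y hy => hb y (hsub hy)
    have hu' : ∀ x y : ℝ, (a' : ℝ) ≤ x → x ≤ y → y ≤ b' → |u y - u x| ≤ C₁ * μ ^ (1 / 2 : ℝ) * (y - x) :=
      fun x y hx hxy hy => hu x y (le_trans (by exact_mod_cast ha') hx) hxy (hy.trans (by exact_mod_cast hb'))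
    have h1 := block_bound hh hC₁ hμ hab' hL hD' hbb u hu'
    refine h1.trans ?_
    rw [hblk, hK]
    have : (96 * h) * (((b' : ℝ) - a') * μ ^ (1 / 6 : ℝ) + ((b' : ℝ) - a') ^ (1 / 2 : ℝ) * μ ^ (-(1 / 6 : ℝ))) ≤
        (96 * h) * ((B : ℝ) * μ ^ (1 / 6 : ℝ) + (B : ℝ) ^ (1 / 2 : ℝ) * μ ^ (-(1 / 6 : ℝ))) := by
      apply mul_le_mul_of_nonneg_left _ (by positivity)
      gcongr
    nlinarith [this, Real.pi_pos]
  -- induction on the number of blocks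
  have hind : ∀ k : ℕ, ∀ b' : ℤ, a ≤ b' → b' ≤ b → b' - a ≤ k * B →
      ‖∑ n ∈ Finset.Ioc a b', e (D 0 n + u n)‖ ≤ k * blk := by
    intro k
    induction k with
    | zero =>
      intro b' hab' _ hlen
      have : b' = a := by push_cast at hlen; omega
      rw [this]; simp
    | succ k ih =>
      intro b' hab' hb'b hlen
      by_cases hsmall : b' - a ≤ k * B
      · have := ih b' hab' hb'b hsmall
        refine this.trans ?_
        push_cast; nlinarith
      · -- split off the last block `(c, b']`, `c = a + kB`
        set c : ℤ := a + k * B with hc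
        have hkB : (0 : ℤ) ≤ k * B := by positivity
        have hac : a ≤ c := by rw [hc]; linarith
        have hcb' : c ≤ b' := by rw [hc]; linarith
        have hsplit : Finset.Ioc a b' = Finset.Ioc a c ∪ Finset.Ioc c b' := by
          rw [Finset.Ioc_union_Ioc_eq_Ioc hac hcb']
        have hdisj : Disjoint (Finset.Ioc a c) (Finset.Ioc c b') :=
          Finset.Ioc_disjoint_Ioc_of_le le_rfl
        rw [hsplit, Finset.sum_union hdisj]
        refine (norm_add_le _ _).trans ?_
        have h1 := ih c hac (hcb'.trans hb'b) (by rw [hc]; linarith)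
        have h2 := hblock c b' hac hcb' hb'b (by rw [hc]; push_cast at hlen; linarith)
        push_cast; linarith
  -- number of blocks
  set k : ℕ := ⌈((b : ℝ) - a) / B⌉₊ with hkdef
  have hB0 : (0 : ℝ) < B := by exact_mod_cast hB1
  have hkbound : b - a ≤ (k : ℤ) * B := by
    have h1 : ((b : ℝ) - a) / B ≤ k := Nat.le_ceil _
    have h2 : (b : ℝ) - a ≤ (k : ℝ) * B := by rwa [div_le_iff₀ hB0] at h1
    exact_mod_cast h2
  have hmain := hind k b hab le_rfl hkbound
  -- `k · blk ≤ 1400 h (1 + 4πC₁) (L μ^{1/12} + L^{1/2} μ^{-1/6})`, `L = b - a`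
  set L : ℝ := (b : ℝ) - a with hLdef
  have hL0 : 0 ≤ L := sub_nonneg.mpr (by exact_mod_cast hab)
  have hk_le : (k : ℝ) ≤ L / B + 1 := (Nat.ceil_lt_add_one (by positivity)).le
  have hB2 : (B : ℝ) ≤ 2 * μ ^ (-(1 / 2 : ℝ)) := by linarith
  have e1 : (B : ℝ) * μ ^ (1 / 6 : ℝ) ≤ 2 * μ ^ (-(1 / 3 : ℝ)) := by
    calc (B : ℝ) * μ ^ (1 / 6 : ℝ) ≤ 2 * μ ^ (-(1 / 2 : ℝ)) * μ ^ (1 / 6 : ℝ) := by gcongr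
      _ = 2 * μ ^ (-(1 / 3 : ℝ)) := by rw [mul_assoc, ← Real.rpow_add hμ]; norm_num
  have e2 : (B : ℝ) ^ (1 / 2 : ℝ) * μ ^ (-(1 / 6 : ℝ)) ≤ 2 * μ ^ (-(5 / 12 : ℝ)) := by
    have h1 : (B : ℝ) ^ (1 / 2 : ℝ) ≤ (2 * μ ^ (-(1 / 2 : ℝ))) ^ (1 / 2 : ℝ) :=
      Real.rpow_le_rpow (by positivity) hB2 (by norm_num)
    have h2 : (2 * μ ^ (-(1 / 2 : ℝ))) ^ (1 / 2 : ℝ) ≤ 2 * μ ^ (-(1 / 4 : ℝ)) := by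
      rw [Real.mul_rpow (by norm_num) (by positivity), ← Real.rpow_mul hμ.le]
      have h3 : (2 : ℝ) ^ (1 / 2 : ℝ) ≤ 2 := by
        have := Real.rpow_le_rpow_of_exponent_le (by norm_num : (1:ℝ) ≤ 2) (by norm_num : (1/2:ℝ) ≤ 1)
        simpa using this
      have h4 : (-(1 / 2 : ℝ)) * (1 / 2) = -(1 / 4) := by norm_num
      rw [h4]
      exact mul_le_mul_of_nonneg_right h3 (by positivity)
    calc (B : ℝ) ^ (1 / 2 : ℝ) * μ ^ (-(1 / 6 : ℝ)) ≤ 2 * μ ^ (-(1 / 4 : ℝ)) * μ ^ (-(1 / 6 : ℝ)) := by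
          gcongr; exact h1.trans h2
      _ = 2 * μ ^ (-(5 / 12 : ℝ)) := by rw [mul_assoc, ← Real.rpow_add hμ]; norm_num
  have e3 : μ ^ (-(1 / 3 : ℝ)) ≤ μ ^ (-(5 / 12 : ℝ)) :=
    Real.rpow_le_rpow_of_exponent_ge hμ hμ1 (by norm_num)
  have hblk_le : blk ≤ K * (4 * μ ^ (-(5 / 12 : ℝ))) := by
    rw [hblk]; apply mul_le_mul_of_nonneg_left _ hK0; linarith
  have hLB : L / B ≤ L * μ ^ (1 / 2 : ℝ) := by
    rw [div_le_iff₀ hB0]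
    have : L * 1 ≤ L * (μ ^ (1 / 2 : ℝ) * B) := by
      apply mul_le_mul_of_nonneg_left _ hL0
      calc (1 : ℝ) = μ ^ (1 / 2 : ℝ) * μ ^ (-(1 / 2 : ℝ)) := by rw [← Real.rpow_add hμ]; norm_num
        _ ≤ μ ^ (1 / 2 : ℝ) * B := by gcongr
    linarith
  have hkμ : (k : ℝ) ≤ L * μ ^ (1 / 2 : ℝ) + 1 := by linarith
  have f1 : μ ^ (1 / 2 : ℝ) * μ ^ (-(5 / 12 : ℝ)) = μ ^ (1 / 12 : ℝ) := by
    rw [← Real.rpow_add hμ]; norm_num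
  have hpos : 0 ≤ L * μ ^ (1 / 12 : ℝ) + L ^ (1 / 2 : ℝ) * μ ^ (-(1 / 6 : ℝ)) := by positivity
  have hh0 : 0 ≤ h := by linarith
  have hc0 : 0 ≤ 1 + 4 * π * C₁ := by positivity
  have hhc : 0 ≤ h * (1 + 4 * π * C₁) * (L * μ ^ (1 / 12 : ℝ) + L ^ (1 / 2 : ℝ) * μ ^ (-(1 / 6 : ℝ))) :=
    mul_nonneg (mul_nonneg hh0 hc0) hpos
  by_cases hcase : L * μ ^ (1 / 2 : ℝ) ≤ 2
  · -- a single (double) block: apply `block_bound` directly on `[a, b]`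
    have h1 := block_bound hh hC₁ hμ hab (by rw [← hLdef]; exact hcase) hD hb u hu
    refine h1.trans ?_
    rw [← hLdef]
    have hμ112 : μ ^ (1 / 6 : ℝ) ≤ μ ^ (1 / 12 : ℝ) :=
      Real.rpow_le_rpow_of_exponent_ge hμ hμ1 (by norm_num)
    have hY : L * μ ^ (1 / 6 : ℝ) + L ^ (1 / 2 : ℝ) * μ ^ (-(1 / 6 : ℝ)) ≤
        L * μ ^ (1 / 12 : ℝ) + L ^ (1 / 2 : ℝ) * μ ^ (-(1 / 6 : ℝ)) := by gcongr
    calc 2 * (1 + 4 * π * C₁) * (96 * h * (L * μ ^ (1 / 6 : ℝ) + L ^ (1 / 2 : ℝ) * μ ^ (-(1 / 6 : ℝ))))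
        = 192 * (h * (1 + 4 * π * C₁)) * (L * μ ^ (1 / 6 : ℝ) + L ^ (1 / 2 : ℝ) * μ ^ (-(1 / 6 : ℝ))) := by
          ring
      _ ≤ 192 * (h * (1 + 4 * π * C₁)) * (L * μ ^ (1 / 12 : ℝ) + L ^ (1 / 2 : ℝ) * μ ^ (-(1 / 6 : ℝ))) :=
          mul_le_mul_of_nonneg_left hY (by positivity)
      _ = 192 * (h * (1 + 4 * π * C₁) * (L * μ ^ (1 / 12 : ℝ) + L ^ (1 / 2 : ℝ) * μ ^ (-(1 / 6 : ℝ)))) := by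
          ring
      _ ≤ 1400 * (h * (1 + 4 * π * C₁) * (L * μ ^ (1 / 12 : ℝ) + L ^ (1 / 2 : ℝ) * μ ^ (-(1 / 6 : ℝ)))) :=
          mul_le_mul_of_nonneg_right (by norm_num) hhc
      _ = _ := by ring
  · -- many blocks: `L μ^{1/2} > 2`, so `μ^{-1/4} ≤ L^{1/2}`
    refine hmain.trans ?_
    rw [not_le] at hcase
    have hμ14 : μ ^ (-(1 / 4 : ℝ)) ≤ L ^ (1 / 2 : ℝ) := by
      have h1 : μ ^ (-(1 / 2 : ℝ)) ≤ L := by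
        have : μ ^ (-(1 / 2 : ℝ)) * (μ ^ (1 / 2 : ℝ)) ≤ L * μ ^ (1 / 2 : ℝ) := by rw [hsqrt]; linarith
        exact le_of_mul_le_mul_right this (Real.rpow_pos_of_pos hμ _)
      have h2 := Real.rpow_le_rpow (by positivity) h1 (by norm_num : (0:ℝ) ≤ 1 / 2)
      rw [← Real.rpow_mul hμ.le] at h2
      have h4 : (-(1 / 2 : ℝ)) * (1 / 2) = -(1 / 4) := by norm_num
      rwa [h4] at h2
    have g1 : μ ^ (-(5 / 12 : ℝ)) ≤ L ^ (1 / 2 : ℝ) * μ ^ (-(1 / 6 : ℝ)) := by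
      have h2 : μ ^ (-(5 / 12 : ℝ)) = μ ^ (-(1 / 4 : ℝ)) * μ ^ (-(1 / 6 : ℝ)) := by
        rw [← Real.rpow_add hμ]; norm_num
      rw [h2]
      exact mul_le_mul_of_nonneg_right hμ14 (by positivity)
    calc (k : ℝ) * blk ≤ (L * μ ^ (1 / 2 : ℝ) + 1) * (K * (4 * μ ^ (-(5 / 12 : ℝ)))) :=
          mul_le_mul hkμ hblk_le hblk0 (by positivity)
      _ = 4 * K * (L * (μ ^ (1 / 2 : ℝ) * μ ^ (-(5 / 12 : ℝ))) + μ ^ (-(5 / 12 : ℝ))) := by ring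
      _ ≤ 4 * K * (L * μ ^ (1 / 12 : ℝ) + L ^ (1 / 2 : ℝ) * μ ^ (-(1 / 6 : ℝ))) := by
          rw [f1]; gcongr
      _ = 768 * (h * (1 + 4 * π * C₁) * (L * μ ^ (1 / 12 : ℝ) + L ^ (1 / 2 : ℝ) * μ ^ (-(1 / 6 : ℝ)))) := by
          rw [hK]; ring
      _ ≤ 1400 * (h * (1 + 4 * π * C₁) * (L * μ ^ (1 / 12 : ℝ) + L ^ (1 / 2 : ℝ) * μ ^ (-(1 / 6 : ℝ)))) :=
          mul_le_mul_of_nonneg_right (by norm_num) hhc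
      _ = _ := by ring

end RobertSargos
end Literature.NumberTheory.LFunctions

end
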